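import Mathlib

/-!
# Rigidity of smooth axisymmetric tangent cones: kernel lemmas (K18)

Solo seat `solo-NavierStokesRegularity-informed`, session 12; companion of the note
`paper/axisymmetric-rigidity.md` (Theorem 8: structure and rigidity of axisymmetric, 1-homogeneous,
locally Lipschitz solutions `C = r (u(φ) e_r + v(φ) e_φ + s(φ) e_α)` of the cone equation
`C + (C·∇)C + ∇π = 0`, `div C = 0` — the candidate tangent cones of a self-similar Euler /
Navier–Stokes profile at a stagnation point).  On a sector where `v ≠ 0` the two quantities
`f = 2(v² + s²) − v u'` and `S = s sin φ` both solve the characteristic equation `v g' = −(1+2u) g`;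
at a cone or pole repelling the sphere flow (`v ≈ a ψ`, `a > 0`) their solutions behave like
`ψ^e` with an explicit characteristic exponent `e`, and the whole of Theorem 8 is the comparison of
`e` with the vanishing order that Lipschitz / C¹ / C² regularity forces.

Certified here (real analysis and arithmetic only; no new definitions):

* `charExp_weight_antitoneOn`, `charExp_eq_zero_of_tendsto`, `charExp_eq_zero_of_pow_bound` —
  LEMMA 8.1 (weighted characteristic lemma): if `v g' = −k g` on `(0, δ]`, `v ψ ≥ a ψ` with
  `a > 0` and `k ≥ −e·a` with `e ≥ 0`, then `ψ ↦ ψ^(−2e) (g ψ)²` is antitone on `(0, δ]`; hence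
  `g ≡ 0` as soon as `ψ^(−2e) (g ψ)² → 0` at `0⁺`, in particular when `|g ψ| ≤ L ψ^m`, `m > e`.
* the exponent table of Theorem 8: `sourceCone_exp` (interior repelling cone with `c ≤ −1/2`:
  `0 ≤ e < 2/3`), `sourcePole_fExp` (`e_f < 4/3`, and `e_f ≥ 1 ↔ c ≤ −2`), `sourcePole_sExp`
  (`0 ≤ e_s < 1/3` for `c ≤ −2`), `sinkCone_exp_ge_one_iff` / `sinkPole_sExp_ge_one_iff`
  (Lipschitz at an attracting cone / pole needs `c ≤ 1`), `sinkCone_exp_quantised_iff`,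
  `sinkPole_sExp_odd_iff` (C^∞ needs `c ∈ {1, 1/4, 1/7, …}`), `poleExp_shift`.
* `swirlCone_pressure`, `swirlCone_no_real_exponent` — at a swirling cone (`v = 0`, `u = −1/2`,
  `s = σ ≠ 0`) the pressure value is forced and the linearisation `(2/3)[[0,2σ],[−2σ,0]]` has no
  real characteristic exponent (`μ² + (16/9)σ² ≠ 0`): the continuous germ is unique and analytic.
* `fluxDensity_hasDerivAt` — `(v sin φ)' = −3 u sin φ` from `div C = 0`; a pole is regular only if
  the flux `∫ u sin φ dφ` over its cap vanishes.
* `ertel_weight_lowering`, `frozenField_bracket` — the Lie-algebraic core of Proposition 8.10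
  (general cones): `[C, ω] = −ω` lowers `C`-weights by one under `ω·∇`, and `N = C − x` commutes
  with `ω`.
-/

namespace Summit.NavierStokesRegularity.NavierStokesRegularity.Theorems

open Set Filter Topology

/-! ## Lemma 8.1: the weighted characteristic lemma -/

/-- LEMMA 8.1 (monotone weight).  If `v g' = -k g` on `(0, δ]` with `v ψ ≥ a ψ`, `a > 0`, and
`k ψ ≥ -(e a)` with `e ≥ 0`, then `ψ ↦ ψ^(-2e) · (g ψ)^2` is antitone on `(0, δ]`. -/
theorem charExp_weight_antitoneOn
    {g g' v k : ℝ → ℝ} {δ a e : ℝ} (ha : 0 < a) (he : 0 ≤ e)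
    (hg : ∀ ψ ∈ Ioc (0 : ℝ) δ, HasDerivAt g (g' ψ) ψ)
    (hv : ∀ ψ ∈ Ioc (0 : ℝ) δ, a * ψ ≤ v ψ)
    (hk : ∀ ψ ∈ Ioc (0 : ℝ) δ, -(e * a) ≤ k ψ)
    (hode : ∀ ψ ∈ Ioc (0 : ℝ) δ, v ψ * g' ψ = -(k ψ * g ψ)) :
    AntitoneOn (fun ψ => ψ ^ (-(2 * e)) * g ψ ^ 2) (Ioc 0 δ) := by
  have hderiv : ∀ ψ ∈ Ioc (0 : ℝ) δ,
      HasDerivAt (fun ψ => ψ ^ (-(2 * e)) * g ψ ^ 2)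
        ((-(2 * e)) * ψ ^ (-(2 * e) - 1) * g ψ ^ 2
          + ψ ^ (-(2 * e)) * (((2 : ℕ) : ℝ) * g ψ ^ (2 - 1) * g' ψ)) ψ := by
    intro ψ hψ
    have h1 : HasDerivAt (fun ψ : ℝ => ψ ^ (-(2 * e))) ((-(2 * e)) * ψ ^ (-(2 * e) - 1)) ψ :=
      Real.hasDerivAt_rpow_const (Or.inl hψ.1.ne')
    exact h1.mul ((hg ψ hψ).pow 2)
  apply antitoneOn_of_deriv_nonpos (convex_Ioc 0 δ)
  · intro ψ hψ
    exact (hderiv ψ hψ).continuousAt.continuousWithinAt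
  · rw [interior_Ioc]
    intro ψ hψ
    exact (hderiv ψ (Ioo_subset_Ioc_self hψ)).differentiableAt.differentiableWithinAt
  · rw [interior_Ioc]
    intro ψ hψ
    have hψ' : ψ ∈ Ioc (0 : ℝ) δ := Ioo_subset_Ioc_self hψ
    have hψpos : 0 < ψ := hψ.1
    rw [(hderiv ψ hψ').deriv]
    simp only [Nat.cast_ofNat, Nat.add_one_sub_one, pow_one]
    -- split ψ^(-2e) = ψ^(-2e-1) · ψ and factor the positive weight
    have hsplit : ψ ^ (-(2 * e)) = ψ ^ (-(2 * e) - 1) * ψ := by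
      rw [← Real.rpow_add_one hψpos.ne']; rw [sub_add_cancel]
    have hP : 0 < ψ ^ (-(2 * e) - 1) := Real.rpow_pos_of_pos hψpos _
    rw [hsplit]
    have hfac : -(2 * e) * ψ ^ (-(2 * e) - 1) * g ψ ^ 2
        + ψ ^ (-(2 * e) - 1) * ψ * (2 * g ψ * g' ψ)
        = ψ ^ (-(2 * e) - 1) * (-(2 * e) * g ψ ^ 2 + 2 * ψ * (g ψ * g' ψ)) := by ring
    rw [hfac]
    apply mul_nonpos_of_nonneg_of_nonpos hP.le
    -- the bracket X := -2e g² + 2ψ g g' satisfies v·X = -2 g² (e v + ψ k) ≤ 0 with v > 0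
    have hvpos : 0 < v ψ := lt_of_lt_of_le (mul_pos ha hψpos) (hv ψ hψ')
    have hX : v ψ * (-(2 * e) * g ψ ^ 2 + 2 * ψ * (g ψ * g' ψ))
        = -(2 * g ψ ^ 2 * (e * v ψ + ψ * k ψ)) := by
      have : v ψ * (-(2 * e) * g ψ ^ 2 + 2 * ψ * (g ψ * g' ψ))
          = -(2 * e) * v ψ * g ψ ^ 2 + 2 * ψ * g ψ * (v ψ * g' ψ) := by ring
      rw [this, hode ψ hψ']; ring
    have hin : 0 ≤ e * v ψ + ψ * k ψ := by
      have h1 : e * (a * ψ) ≤ e * v ψ := mul_le_mul_of_nonneg_left (hv ψ hψ') he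
      have h2 : ψ * (-(e * a)) ≤ ψ * k ψ := mul_le_mul_of_nonneg_left (hk ψ hψ') hψpos.le
      nlinarith
    have hvX : v ψ * (-(2 * e) * g ψ ^ 2 + 2 * ψ * (g ψ * g' ψ)) ≤ 0 := by
      rw [hX]
      have : 0 ≤ 2 * g ψ ^ 2 * (e * v ψ + ψ * k ψ) := by positivity
      linarith
    by_contra hcon
    push Not at hcon
    have := mul_pos hvpos hcon
    linarith

/-- LEMMA 8.1 (vanishing).  Under the hypotheses of `charExp_weight_antitoneOn`, if the weight
`ψ^(-2e) (g ψ)^2` tends to `0` as `ψ ↓ 0`, then `g ≡ 0` on `(0, δ]`. -/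
theorem charExp_eq_zero_of_tendsto
    {g g' v k : ℝ → ℝ} {δ a e : ℝ} (ha : 0 < a) (he : 0 ≤ e)
    (hg : ∀ ψ ∈ Ioc (0 : ℝ) δ, HasDerivAt g (g' ψ) ψ)
    (hv : ∀ ψ ∈ Ioc (0 : ℝ) δ, a * ψ ≤ v ψ)
    (hk : ∀ ψ ∈ Ioc (0 : ℝ) δ, -(e * a) ≤ k ψ)
    (hode : ∀ ψ ∈ Ioc (0 : ℝ) δ, v ψ * g' ψ = -(k ψ * g ψ))
    (h0 : Tendsto (fun ψ => ψ ^ (-(2 * e)) * g ψ ^ 2) (𝓝[>] 0) (𝓝 0)) :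
    ∀ ψ ∈ Ioc (0 : ℝ) δ, g ψ = 0 := by
  intro ψ₀ hψ₀
  by_contra hne
  have hA := charExp_weight_antitoneOn ha he hg hv hk hode
  have hFpos : 0 < ψ₀ ^ (-(2 * e)) * g ψ₀ ^ 2 := by
    have h1 : 0 < ψ₀ ^ (-(2 * e)) := Real.rpow_pos_of_pos hψ₀.1 _
    have h2 : 0 < g ψ₀ ^ 2 := by rw [pow_two]; exact mul_self_pos.mpr hne
    exact mul_pos h1 h2
  have hev1 : ∀ᶠ ψ in 𝓝[>] (0 : ℝ), ψ ^ (-(2 * e)) * g ψ ^ 2 < ψ₀ ^ (-(2 * e)) * g ψ₀ ^ 2 :=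
    h0.eventually_lt_const hFpos
  have hev2 : ∀ᶠ ψ in 𝓝[>] (0 : ℝ), ψ ∈ Ioo 0 ψ₀ := Ioo_mem_nhdsGT hψ₀.1
  obtain ⟨ψ, h1, h2⟩ := (hev1.and hev2).exists
  have hψmem : ψ ∈ Ioc (0 : ℝ) δ := ⟨h2.1, h2.2.le.trans hψ₀.2⟩
  have hmono : ψ₀ ^ (-(2 * e)) * g ψ₀ ^ 2 ≤ ψ ^ (-(2 * e)) * g ψ ^ 2 := hA hψmem hψ₀ h2.2.le
  linarith

/-- LEMMA 8.1 (exponent gap).  Under the hypotheses of `charExp_weight_antitoneOn`, a solution with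
`|g ψ| ≤ L ψ^m` on `(0, δ]` for some `m > e` vanishes identically: the characteristic exponent `e`
at a repelling cone is beaten by the vanishing order `m` that the regularity of the cone field
forces (`m = 1` for Lipschitz data, `m = 2` for C² data). -/
theorem charExp_eq_zero_of_pow_bound
    {g g' v k : ℝ → ℝ} {δ a e m L : ℝ} (ha : 0 < a) (he : 0 ≤ e) (hδ : 0 < δ) (hm : e < m)
    (hg : ∀ ψ ∈ Ioc (0 : ℝ) δ, HasDerivAt g (g' ψ) ψ)
    (hv : ∀ ψ ∈ Ioc (0 : ℝ) δ, a * ψ ≤ v ψ)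
    (hk : ∀ ψ ∈ Ioc (0 : ℝ) δ, -(e * a) ≤ k ψ)
    (hode : ∀ ψ ∈ Ioc (0 : ℝ) δ, v ψ * g' ψ = -(k ψ * g ψ))
    (hL : ∀ ψ ∈ Ioc (0 : ℝ) δ, |g ψ| ≤ L * ψ ^ m) :
    ∀ ψ ∈ Ioc (0 : ℝ) δ, g ψ = 0 := by
  apply charExp_eq_zero_of_tendsto ha he hg hv hk hode
  -- squeeze: 0 ≤ ψ^(-2e) g² ≤ L·L·ψ^(m+m-2e) → 0
  have hp : 0 < m + m + -(2 * e) := by linarith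
  have hup : ∀ ψ ∈ Ioc (0 : ℝ) δ,
      ψ ^ (-(2 * e)) * g ψ ^ 2 ≤ L * L * ψ ^ (m + m + -(2 * e)) := by
    intro ψ hψ
    have hψpos : 0 < ψ := hψ.1
    have hL0 : 0 ≤ L * ψ ^ m := (abs_nonneg _).trans (hL ψ hψ)
    have hsq : g ψ ^ 2 ≤ (L * ψ ^ m) * (L * ψ ^ m) := by
      rw [pow_two, ← abs_mul_abs_self (g ψ)]
      exact mul_le_mul (hL ψ hψ) (hL ψ hψ) (abs_nonneg _) hL0
    have hw : 0 ≤ ψ ^ (-(2 * e)) := (Real.rpow_pos_of_pos hψpos _).le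
    calc ψ ^ (-(2 * e)) * g ψ ^ 2
        ≤ ψ ^ (-(2 * e)) * ((L * ψ ^ m) * (L * ψ ^ m)) := mul_le_mul_of_nonneg_left hsq hw
      _ = L * L * (ψ ^ m * ψ ^ m * ψ ^ (-(2 * e))) := by ring
      _ = L * L * ψ ^ (m + m + -(2 * e)) := by
          rw [Real.rpow_add hψpos, Real.rpow_add hψpos]
  have hlow : ∀ ψ ∈ Ioc (0 : ℝ) δ, 0 ≤ ψ ^ (-(2 * e)) * g ψ ^ 2 := by
    intro ψ hψ
    exact mul_nonneg (Real.rpow_pos_of_pos hψ.1 _).le (sq_nonneg _)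
  have hmem : ∀ᶠ ψ in 𝓝[>] (0 : ℝ), ψ ∈ Ioc (0 : ℝ) δ := Ioc_mem_nhdsGT hδ
  have hlim : Tendsto (fun ψ : ℝ => L * L * ψ ^ (m + m + -(2 * e))) (𝓝[>] 0) (𝓝 0) := by
    have hc : Tendsto (fun ψ : ℝ => ψ ^ (m + m + -(2 * e))) (𝓝 (0 : ℝ)) (𝓝 0) := by
      have := (Real.continuousAt_rpow_const 0 (m + m + -(2 * e)) (Or.inr hp.le)).tendsto
      simpa [Real.zero_rpow hp.ne'] using this
    have hc' : Tendsto (fun ψ : ℝ => ψ ^ (m + m + -(2 * e))) (𝓝[>] (0 : ℝ)) (𝓝 0) :=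
      hc.mono_left nhdsWithin_le_nhds
    have := hc'.const_mul (L * L)
    simpa using this
  refine tendsto_of_tendsto_of_tendsto_of_le_of_le' tendsto_const_nhds hlim ?_ ?_
  · exact hmem.mono fun ψ hψ => hlow ψ hψ
  · exact hmem.mono fun ψ hψ => hup ψ hψ

/-! ## The exponent table of Theorem 8

At a zero of `v` with normal strain `c = u`, `div C = 0` gives `v' = -3c` (interior cone) or
`v ∼ -(3/2) c φ` (pole).  Near a repelling end (`c < 0`) the characteristic solutions behave like
`ψ^e` with `e = (1+2c)/(3c)` (interior, for `f` and `S`), `e_f = 2(1+2c)/(3c)`, `e_s = (2+c)/(3c)`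
(pole); near an attracting end (`c > 0`) with the same formulas read with `ψ ↓ 0`. -/

/-- Interior repelling cone with `c ≤ -1/2`: the exponent `e = (1+2c)/(3c)` lies in `[0, 2/3)`, below
the order `1` forced by Lipschitz data — so `f` and the swirl vanish on the emanating sectors. -/
theorem sourceCone_exp {c : ℝ} (hc : c ≤ -1 / 2) :
    0 ≤ (1 + 2 * c) / (3 * c) ∧ (1 + 2 * c) / (3 * c) < 2 / 3 := by
  have h3 : 3 * c < 0 := by linarith
  constructor
  · rw [le_div_iff_of_neg h3]; linarith
  · rw [div_lt_iff_of_neg h3]; linarith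

/-- Repelling pole with `c ≤ -1/2`: the `f`-exponent `e_f = 2(1+2c)/(3c)` lies in `[0, 4/3)`, below
the order `2` forced by C² data; and `e_f ≥ 1` (compatible with Lipschitz data) iff `c ≤ -2`. -/
theorem sourcePole_fExp {c : ℝ} (hc : c ≤ -1 / 2) :
    0 ≤ 2 * (1 + 2 * c) / (3 * c) ∧ 2 * (1 + 2 * c) / (3 * c) < 4 / 3
      ∧ (1 ≤ 2 * (1 + 2 * c) / (3 * c) ↔ c ≤ -2) := by
  have h3 : 3 * c < 0 := by linarith
  refine ⟨?_, ?_, ?_⟩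
  · rw [le_div_iff_of_neg h3]; linarith
  · rw [div_lt_iff_of_neg h3]; linarith
  · rw [le_div_iff_of_neg h3]; constructor <;> intro h <;> linarith

/-- Repelling pole with `c ≤ -2`: the swirl exponent `e_s = (2+c)/(3c)` lies in `[0, 1/3)`, below the
order `1` forced by Lipschitz data — polar caps of a Lipschitz axisymmetric cone carry no swirl. -/
theorem sourcePole_sExp {c : ℝ} (hc : c ≤ -2) :
    0 ≤ (2 + c) / (3 * c) ∧ (2 + c) / (3 * c) < 1 / 3 := by
  have h3 : 3 * c < 0 := by linarith
  constructor
  · rw [le_div_iff_of_neg h3]; linarith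
  · rw [div_lt_iff_of_neg h3]; linarith

/-- At a pole the `f`-exponent exceeds the swirl exponent by exactly one (`f = λ · s sin φ`). -/
theorem poleExp_shift {c : ℝ} (hc : c ≠ 0) :
    2 * (1 + 2 * c) / (3 * c) = (2 + c) / (3 * c) + 1 := by
  field_simp
  ring

/-- Attracting interior cone (`c > 0`): the exponent `(1+2c)/(3c)` is `≥ 1` (Lipschitz gluing of a
vortical sector) iff `c ≤ 1`. -/
theorem sinkCone_exp_ge_one_iff {c : ℝ} (hc : 0 < c) :
    1 ≤ (1 + 2 * c) / (3 * c) ↔ c ≤ 1 := by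
  rw [le_div_iff₀ (by linarith)]
  constructor <;> intro h <;> linarith

/-- Attracting interior cone: the exponent is an integer `j` (necessary for a C^∞ gluing of a
vortical sector) iff `c (3j - 2) = 1`, i.e. `c ∈ {1, 1/4, 1/7, …}`. -/
theorem sinkCone_exp_quantised_iff {c j : ℝ} (hc : 0 < c) :
    (1 + 2 * c) / (3 * c) = j ↔ c * (3 * j - 2) = 1 := by
  rw [div_eq_iff (by positivity)]
  constructor <;> intro h <;> linarith

/-- Attracting pole (`c > 0`): the swirl exponent `(2+c)/(3c)` is `≥ 1` iff `c ≤ 1`. -/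
theorem sinkPole_sExp_ge_one_iff {c : ℝ} (hc : 0 < c) :
    1 ≤ (2 + c) / (3 * c) ↔ c ≤ 1 := by
  rw [le_div_iff₀ (by linarith)]
  constructor <;> intro h <;> linarith

/-- Attracting pole: the swirl exponent is an odd integer `2j+1` (parity of a smooth azimuthal
component) iff `c (3j + 1) = 1`, i.e. `c ∈ {1, 1/4, 1/7, …}` — the corrected onset list of
Remark 6.2(i). -/
theorem sinkPole_sExp_odd_iff {c j : ℝ} (hc : 0 < c) :
    (2 + c) / (3 * c) = 2 * j + 1 ↔ c * (3 * j + 1) = 1 := by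
  rw [div_eq_iff (by positivity)]
  constructor <;> intro h <;> linarith

/-! ## Swirling cones -/

/-- At a swirling cone (`v = 0`, `u = -1/2`) the radial cone equation
`v u' = v² + s² - 2p - u - u²` forces the pressure value `p = (s² + 1/4)/2`. -/
theorem swirlCone_pressure {u u' v s p : ℝ}
    (h : v * u' = v ^ 2 + s ^ 2 - 2 * p - u - u ^ 2) (hv : v = 0) (hu : u = -1 / 2) :
    p = (s ^ 2 + 1 / 4) / 2 := by
  subst hv; subst hu
  nlinarith [h]

/-- The linearisation `ψ (δu, δs)' = (2/3) [[0, 2σ], [-2σ, 0]] (δu, δs)` at a swirling cone with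
`σ ≠ 0` has characteristic polynomial `μ² + (16/9) σ²`, without real roots: no real characteristic
exponent, so the germ continuous at the cone is the unique analytic one (Briot–Bouquet). -/
theorem swirlCone_no_real_exponent {σ : ℝ} (hσ : σ ≠ 0) (μ : ℝ) :
    μ ^ 2 + 16 / 9 * σ ^ 2 ≠ 0 := by
  have hσ2 : 0 < σ ^ 2 := by rw [pow_two]; exact mul_self_pos.mpr hσ
  have hμ2 : 0 ≤ μ ^ 2 := sq_nonneg μ
  intro h
  linarith

/-- The order-`n` Taylor recursion at a swirling cone has matrix `[[3n/2, -2σ], [2σ, 3n/2]]` with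
determinant `9n²/4 + 4σ² > 0` for `n ≥ 1`: every Taylor coefficient is uniquely determined by
`(φ₁, σ)`. -/
theorem swirlCone_recursion_det_pos (σ : ℝ) {n : ℕ} (hn : 1 ≤ n) :
    0 < (3 * (n : ℝ) / 2) * (3 * n / 2) - (-2 * σ) * (2 * σ) := by
  have hn' : (1 : ℝ) ≤ n := by exact_mod_cast hn
  nlinarith [sq_nonneg σ]

/-! ## The flux condition at a pole -/

/-- From `div C = 0` in the form `3u + v' + v cot φ = 0` (with `sin φ ≠ 0`):
`(v sin φ)' = -3 u sin φ`.  Integrated over a polar cap this is the flux condition: the pole is a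
regular point of `v` only if `∫ u sin φ dφ` over the cap vanishes (otherwise `v ∼ 3M/φ`). -/
theorem fluxDensity_hasDerivAt {v : ℝ → ℝ} {v' u φ : ℝ}
    (hv : HasDerivAt v v' φ) (hsin : Real.sin φ ≠ 0)
    (hdiv : 3 * u + v' + v φ * (Real.cos φ / Real.sin φ) = 0) :
    HasDerivAt (fun x => v x * Real.sin x) (-(3 * u * Real.sin φ)) φ := by
  have h : HasDerivAt (fun x => v x * Real.sin x) (v' * Real.sin φ + v φ * Real.cos φ) φ :=
    hv.mul (Real.hasDerivAt_sin φ)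
  refine h.congr_deriv ?_
  have e : v φ * Real.cos φ = v φ * (Real.cos φ / Real.sin φ) * Real.sin φ := by
    rw [mul_assoc, div_mul_cancel₀ _ hsin]
  have h3 : (3 * u + v' + v φ * (Real.cos φ / Real.sin φ)) * Real.sin φ = 0 := by
    rw [hdiv]; ring
  rw [e]
  linear_combination h3

/-! ## Proposition 8.10: the Ertel ladder (Lie-algebraic core) -/

section Ertel

variable {R L M : Type*} [CommRing R] [LieRing L] [LieAlgebra R L]
  [AddCommGroup M] [Module R M] [LieRingModule L M] [LieModule R L M]

/-- ERTEL WEIGHT-LOWERING.  If `[c, w] = -w` (the vorticity equation of the cone equation: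
`[C, ω] = -ω`) and `g` has `c`-weight `μ` (`c · g = μ g`), then `w · g` has `c`-weight `μ - 1`.
Iterating from `F = x·(C×ω)` (weight `-1`) gives the ladder `ω·∇F` (weight `-2`),
`(ω·∇)²F` (weight `-3`), … of Proposition 8.10. -/
theorem ertel_weight_lowering (c w : L) (g : M) (μ : R)
    (hcw : ⁅c, w⁆ = -w) (hg : ⁅c, g⁆ = μ • g) :
    ⁅c, ⁅w, g⁆⁆ = (μ - 1) • ⁅w, g⁆ := by
  calc ⁅c, ⁅w, g⁆⁆ = ⁅⁅c, w⁆, g⁆ + ⁅w, ⁅c, g⁆⁆ := leibniz_lie c w g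
    _ = ⁅-w, g⁆ + ⁅w, μ • g⁆ := by rw [hcw, hg]
    _ = -⁅w, g⁆ + μ • ⁅w, g⁆ := by rw [neg_lie, lie_smul]
    _ = (μ - 1) • ⁅w, g⁆ := by rw [sub_smul, one_smul]; abel

/-- FROZEN FIELD.  If `[c, w] = -w` and `[e, w] = -w` (`e` = the Euler field `x·∇`, `w` = a
degree-zero field), then `n = c - e` commutes with `w`: the vorticity of a homogeneous cone is
frozen into `N = C - x`. -/
theorem frozenField_bracket (c e w : L) (hcw : ⁅c, w⁆ = -w) (hew : ⁅e, w⁆ = -w) :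
    ⁅c - e, w⁆ = 0 := by
  rw [sub_lie, hcw, hew, sub_self]

end Ertel

end Summit.NavierStokesRegularity.NavierStokesRegularity.Theorems
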